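import Summits.BirchSwinnertonDyer.Rank1Residual.Additive.RamifiedSevenResidueIsGenusUnitClassOfIntegralComparison
import Literature.NumberTheory.EllipticCurves.Kato2004.IwasawaCohomologyNumberFieldIsogeny
import HarnessLib

set_option autoImplicit false

/-!
# `𝒞₇` genus road (crux `EllipticUnitValueSevenOfGZK`, K7r), row (K2C-2) block (R3): THE DUAL-EXPONENTIAL COLUMN of the
# pinned frame — the HYPOTHESIS DATUM `DualExpValueDatum hγ Φ` («the `χ`-components of `exp*` on
# `𝐇′(S′_W) = Φ.IK.H`, read in ℂ», with Kato's value laws for the elliptic-unit classes and for the ★-class), the `Prop`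
# `DualExpCompatShape`, and its elementary API; a structure and a predicate — NOTHING asserted, NO named fact

Cell bsd-cm, seat bsd-cm-prr-ty1 g30 (literature-prover), SUMMON `wake/SUMMON-bsd-cm-prr-ty1-20260830T1605Z.md`
(903ea518e552576d; planner D905) block (R3); pen rulings D907 (design GO with adjustments (a)–(d)) / D908 ((SEP) PASS);
STATUS CHECKS (12.5), (BK-res), (SEP) of 2026-08-30.  Imports (P3) `RamifiedSevenResidueIsGenusUnitClassOfIntegralComparison`
(the three shapes at a pinned frame) and (L) `Kato2004/IwasawaCohomologyNumberFieldIsogeny` (the constructed CM operator,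
used to prove `piK ∘ piK = −7`).  HONEST LABEL: a hypothesis structure, a predicate and kernel lemmas about them; nothing is
asserted to exist; no stub is closed; stmt-BirchSwinnertonDyer-19945 is OPEN; `X12.CMRamifiedSeven` is NOT proved; no
summit statement is proved by this seat; BSD is claimed for no curve.

## Why a datum (CHECK (12.5) / (BK-res), pen D907) and what it says

The rational half `RationalComparisonShape Φ` of the registered K2ᶜ stub (`IntegralComparisonShape` = rational ∧ divisibility,
(P3)) is Kato's argument «the dual-exponential VALUES of `EU_𝔟` and of `𝐳_{γ′}` agree at almost all finite-order characters;
elements of the rank-one branch are SEPARATED by their values» ((15.16.1) from Prop. 15.9 + Thm. 12.5 (1) + Thm. 12.4 (2) +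
13.5).  The pinned frame carries the `K`-side value datum `Φ.𝔏` only as an abstract `ℤ₇`-linear map per layer with (Z3a)
equivariance on TORSION layers, the ★-class `Φ.zOne` only through a POSITION (up to `Λˣ`, and only relative to a realised
family — vacuous without (E2)), and no ℚ-side value datum at all (that lives inside ★'s realised families, on cyclotomic
LEVELS).  So the value theory the argument runs on is typed HERE as ONE hypothesis datum over the frame, each field a
print/functoriality statement about Kato's objects (cited), in the frame's own complex currency ((Z5) of `CM.EllipticZetaBody`,
`CM.IsDepletedHeckeL`, `Φ.Ω`, `Φ.ιC`):
* `ι₇ : ℚ_[7] →+* ℂ` — a complex reading of `7`-adic coefficients; CONSTRUCTIBLE for the genuine frame (Mathlib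
  `IsAlgClosed.ringEquivOfCardinalEqOfCharEq`: `AlgebraicClosure ℚ_[7] ≃+* ℂ`, both algebraically closed of characteristic `0`
  and cardinality continuum), so `Nonempty (DualExpValueDatum …)` is never blocked on `ι₇`; it is used only on the
  `ℤ₇`-coefficients of Amice residues (through `charEval` of block (R)); no continuity is claimed or used (pen D912 (ii));
* `val χ : Φ.IK.H →+ ℂ` for every continuous `χ : Γ_{Kcm} →ₜ* ℂˣ` — «the `χ`-component `Σ_{σ} χ(σ)·σ(exp*(x)_{Kℚ_n})` of the
  dual exponential at the layer through which `χ` factors, in the coordinate `ω` of `S(ψ)`, read in ℂ» (Kato Thm. 12.5 (1)'s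
  functional; Prop. 15.9's `Σ_σ χ(σ) per_ψ(σ ·)`);
* (e1) `val χ ((1+X) • x) = χ(γK)⁻¹·val χ x` — naturality of `exp*` for `γK` acting on `H¹(Kℚ_n, T)` by conjugation and on
  `Kℚ_n ⊗ D` through `Kℚ_n` (Bloch–Kato Def. 3.10: `exp` is the connecting map of (3.8.4), natural; Kato (15.8.1)); Ω-free;
  (e1′) `val χ (C c • x) = ι₇ c·val χ x` — `ℤ₇`-linearity; (e2) `val χ (piK x) = ιC(√−7)·val χ x` — functoriality of `exp*` in
  `V` for `T₇φ` and the CM normalisation «`O_K ≅ End(E)` on `Lie(E)`» (§15.3); Ω-free, and it fixes the sign `φ ↔ sqrtNegSeven`;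
* (eV) `val χ (euK 𝔟) = (N𝔟 − ψ(𝔟)·χ(𝔟)⁻¹)·Ω⁻¹·L_{7f}(ψ̄, χ, 1)` for `χ` trivial on `U_n` — TRANSCRIBES the frame's own
  (Z4)(Z5) of `Φ.euK_spec`/`CM.EllipticZetaBody` (`exists_valueLaw_layer_of_isTwist` in (P3)) read through (e1) on the
  CYCLOTOMIC layers; it is a field (not a theorem) only because the frame's (Z3a) equivariance is stated on torsion layers
  (pen D907 (d): duplication explicit);
* (eZ) the ★-class: `zStar` with `uStar • zStar = res zOne` (`uStar ∈ Λˣ` the ★-unit) has values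
  `7^e·val χ zStar = (α₀ + α₁√−7)·Ω⁻¹·L_{7f}(ψ̄, χ, 1)` for `χ` of PRIMITIVE level `n+1 ≥ n₀+1` — Thm. 12.5 (1) ∘ Shapiro/15.14 ∘
  naturality of `exp*` under restriction ∘ Artin formalism `L(f_D, χ, s) = L(ψ_D·(χ∘N), s)` (memo LEMMA C) ∘ the ★-position;
  `α₀ + α₁√−7 ∈ K^×` absorbs `Ω_W/Ω ∈ K^×` (CM periods) and the rational constants `q, q⁻`, the exponent `e` the `7`-powers,
  `n₀` the finitely many zeros of Kato's multiplier `M̃(χ)` — the ONE place a period quotient enters, RELATIVE to `Φ.Ω`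
  ((r2)∘(r3)∘(r6) of (P3)'s ledger in one typed pin, CHECK (12.5)).  JUSTIFICATION OF THE HYPOTHESIS DATUM (not asserted;
  under critic review, pen D911 (3)(ii), director (619)/(624)): (N★) «`α·7^{−(e+k)}·Ω_★/Ω` is a `7`-unit of `K_𝔭`» and LEMMA P
  of idea-20's memo `Cruxes/EllipticUnitValueSevenOfGZK/DivisibilityKernel-g64.md` §4 (REV 1.1, commit bfa48bf0f321): the
  Prop.-15.9 period of a Betti vector is `Ω(γ₀) = 2κ(γ₀)·Ω_★` with `δ = [κ(γ₀)]γ₀`, `Ω_★ = W.realPeriodRat` up to `±2^j` (Kato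
  15.11 (2), pp. 261–262: `V_L(ψ) ≅ V_F(f) ⊗ L` and the period maps `per_ψ`/`per_f`), and at a generator `γ_gen` of the
  `O_K`-lattice `v_𝔭(κ(γ_gen)) = a_W` ((L3) of the frozen memo) — whence `α ∈ K^×` with the valuation bookkeeping
  `v_𝔭(α) = v_𝔭(Ω_★/Ω) + 2(e+k)` that block (R) carries in its explicit constants; a reading of print + the cell's memo,
  recorded as the reason the pin is inhabited by Kato's objects, NOT as a field and NOT as a named fact (pen D912 (i));
* (psiK) `2ψ(𝔟) = b₀(𝔟) + b₁(𝔟)√−7`, `b_i(𝔟) ∈ ℤ` (ψ(𝔟) ∈ O_K, §15.7); (art) `χ(𝔟) = χ(γK)^{a_𝔟}` for `χ` of finite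
  level (Artin reciprocity on `Kℚ_∞/K`) — both SKOLEMISED (functions `bCoef₀ bCoef₁ artExp` of `𝔟`, not `∃`), so that the
  constants of block (R) are explicit terms (pen D911 (1)/D913).
The SEPARATE binders of block (R) — (tf) Λ-torsion-freeness of `Φ.IK.H`, (rk) rank-one dependence over `Λ[piK]`, (ht′)
`t` invertible in `Λ_O[1/π]`, (r5′) generic non-vanishing, existence of characters and of the entire continuations — are
NOT part of this datum (pen D907 (a)(b)).

## Contents
§1 the datum and the `Prop`; §2 API: `sqrtC` facts (`ιC(√−7)² = −7`, `α₀ + α₁√−7 ≠ 0`), `piK` commutes with `Λ`,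
`piK ∘ piK = −7` (from (L) `isogenyMap_sq_of_comp_self_eq_zsmul` and `φ_sq`), `(χ γK)⁻¹` is a `7^{n+1}`-th root of unity
for `χ` trivial on `U_{n+1}`, values of `zStar` are non-zero where `L ≠ 0`; §3 the EXPLICIT data of block (R) —
`D.xTilde 𝔟 = 2N𝔟 − (b₀(𝔟) + b₁(𝔟)π)(1+X)^{a_𝔟}` (twice Kato's `x_𝔟`, standing in for the unpinned `Φ.frame.x 𝔟`),
`D.cZ = (α₀ − α₁π)·7^e·uStar⁻¹·7^k·u·π^a`, `D.normA = α₀² + 7α₁²`, `D.jα = v₇(normA)`, `D.wα = v^{jα}·(2normA/7^{jα})` —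
and the exact-constant predicates
`TwoSidedComparisonShape Φ x s c` («`s • EU_𝔟 = (c·x_𝔟) • 𝐳_{γ′}`», re-stated from idea-20's workfile REV 1.1, commit
bfa48bf0f321, with `x` a parameter) and `PeriodScaledComparisonShape Φ x n c` («`π^n • EU_𝔟 = (c·x_𝔟) • 𝐳_{γ′}`») with
`.periodScaled` / `.rational` down to (P3)'s `RationalComparisonShape` (pen D911 (1)/D913).

References: K. Kato, Astérisque 295 (2004) Prop. 15.9 / (15.9.1) (pp. 258–259), §15.3 (p. 252), §15.7 (p. 256), (15.8.1)
(p. 257), (15.12.2) (p. 263), 15.14 (p. 264), (15.16.1) (p. 265), Thm. 12.4 (2) / 12.5 (1) (p. 221), §13.9 (p. 230), 13.5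
(p. 227) [Kato2004Asterisque]; S. Bloch, K. Kato (1990) Def. 3.10, Ex. 3.10.1–3.11 (pp. 359–361) [BlochKato1990]; K. Kato,
LNM 1553 (1993) Ch. II §1.2 [Kato1993LNM1553]; J. Neukirch, A. Schmidt, K. Wingberg (2008) I §5–§6 [NeukirchSchmidtWingberg2008];
(P1) p776025, (P3) p776568, (L) p776319, (A) p777087; CHECKs (12.5)/(BK-res)/(SEP); `K2cCollapse-g57.md` §2 LEMMA S.
-/

noncomputable section

open scoped NumberField TensorProduct
open Field IsDedekindDomain NumberField
open Literature.NumberTheory.GaloisRepresentations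
open Literature.NumberTheory.EllipticCurves
open Literature.NumberTheory.EllipticCurves.Rank1Residual
open Literature.NumberTheory.EllipticCurves.IwasawaAlgebra
open Literature.NumberTheory.EllipticCurves.Kato2004
open Literature.NumberTheory.ComplexMultiplication.EllipticUnits
open Summit.BirchSwinnertonDyer.Rank1Residual

namespace Summit.BirchSwinnertonDyer.Rank1Residual.Additive.GenusSeven

section Frame

variable {W : WeierstrassCurve ℚ} [W.IsElliptic] [W.IsGloballyMinimal] [Fact (Nat.Prime 7)]
  [ContinuousSMul ℤ_[7] (W.tateModule 7)] {K : ZpExtension ℚ 7} {hK : K.IsCyclotomic}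
  {γ : Field.absoluteGaloisGroup ℚ} {I : IwasawaH1Data W 7 K γ}
  {F : GenusFrame} {θu : ∀ n : ℕ, globalUnitsOf (F.layer n)} {d : GenusDatum F θu}

/-! ## §1 The dual-exponential value datum of a pinned frame -/

/-- **`DualExpValueDatum hγ Φ` — the `χ`-components of the dual exponential on `𝐇′(S′_W) = Φ.IK.H`, read in ℂ, with
Kato's value laws for the (λ1) classes `euK 𝔟` and for the ★-class** (module docstring «Why a datum»): data `ι₇`, `val χ`,
the `Λˣ`-normalised ★-class `zStar` and its value constants `(e, α₀, α₁, n₀)`; axioms (e1)(e1′)(e2) (naturality /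
linearity / CM-functoriality of `exp*`), (eV) (= the frame's (Z4)(Z5) on the cyclotomic layers), (eZ) (Thm. 12.5 (1) ∘
Shapiro ∘ `exp*`-restriction ∘ Artin formalism ∘ ★), (psiK) (`ψ(𝔟) ∈ O_K`), (art) (Artin reciprocity).  A HYPOTHESIS
STRUCTURE; nothing is asserted to exist; no named fact.
[cite: Kato2004Asterisque, Prop. 15.9 (15.9.1) (pp. 258–259), Thm. 12.5 (1) (p. 221), (15.12.2) (p. 263), 15.14 (p. 264), (15.16.1) (p. 265), §15.7 (p. 256)]
[cite: BlochKato1990, Def. 3.10 and Ex. 3.10.1–3.11 (pp. 359–361)] [cite: NeukirchSchmidtWingberg2008, I §5–§6] -/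
structure DualExpValueDatum (hγ : K.IsTopGenerator γ) (Φ : PinnedKatoGenusFrame W K hK I d) : Type where
  /-- A complex reading of `7`-adic coefficients. -/
  ι₇ : ℚ_[7] →+* ℂ
  /-- The `χ`-component of `exp*` on `𝐇′(S′_W)`, read in ℂ, for every continuous character `χ` of `Γ_{Kcm}`. -/
  val : (absoluteGaloisGroup Φ.Kcm →ₜ* ℂˣ) → (Φ.IK.H →+ ℂ)
  /-- (e1) naturality of `exp*`: `γK` acts on the `χ`-component by `χ(γK)⁻¹`. -/
  val_T : ∀ (χ : absoluteGaloisGroup Φ.Kcm →ₜ* ℂˣ) (x : Φ.IK.H),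
    val χ ((1 + PowerSeries.X : IwasawaAlgebra 7) • x) = (((χ Φ.γK)⁻¹ : ℂˣ) : ℂ) * val χ x
  /-- (e1′) `ℤ₇`-linearity, read through `ι₇`. -/
  val_C : ∀ (χ : absoluteGaloisGroup Φ.Kcm →ₜ* ℂˣ) (c : ℤ_[7]) (x : Φ.IK.H),
    val χ ((PowerSeries.C c : IwasawaAlgebra 7) • x) = ι₇ (c : ℚ_[7]) * val χ x
  /-- (e2) CM-functoriality: the CM operator `piK` (`= (T₇φ)_*`) acts on values by `ιC(√−7)`. -/
  val_piK : ∀ (χ : absoluteGaloisGroup Φ.Kcm →ₜ* ℂˣ) (x : Φ.IK.H),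
    val χ (Φ.piK x) = Φ.ιC (algebraMap Φ.Kcm (AlgebraicClosure Φ.Kcm) Φ.sqrtNegSeven) * val χ x
  /-- (eV) the values of the elliptic-unit classes: (15.9.1) on the cyclotomic layer `Kℚ_n` (= the frame's (Z4)(Z5)). -/
  val_euK : ∀ (𝔟 : Ideal (𝓞 Φ.Kcm)), IsTwist 7 Φ.𝔣 𝔟 → ∀ (n : ℕ) (χ : absoluteGaloisGroup Φ.Kcm →ₜ* ℂˣ),
    (∀ σ ∈ (K.restrictOfFinrankEqTwo (by decide) Φ.Kcm Φ.finrank_Kcm).layerSubgroup n, χ σ = 1) →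
    ∀ Lf : ℂ → ℂ, CM.IsDepletedHeckeL Φ.ψ χ (7 * (7 * F.d)) Lf →
      val χ (Φ.euK 𝔟) =
        (((Ideal.absNorm 𝔟 : ℕ) : ℂ) - CM.heckeCharIdealValue Φ.ψ 𝔟 * (heckeIdealValue χ 𝔟)⁻¹) * Φ.Ω⁻¹ * Lf 1
  /-- (eZ) the ★-unit and the `Λˣ`-normalised ★-class `zStar` (`uStar • zStar = res zOne`) … -/
  uStar : (IwasawaAlgebra 7)ˣ
  zStar : Φ.IK.H
  uStar_smul_zStar : ((uStar : IwasawaAlgebra 7)) • zStar = I.resOver Φ.IK hγ Φ.isTopGenerator_γK Φ.zOne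
  /-- … its value constants: a `7`-power `7^e`, `α = α₀ + α₁√−7 ∈ K^×`, a threshold `n₀` … -/
  e : ℕ
  α₀ : ℤ
  α₁ : ℤ
  α_ne_zero : α₀ ≠ 0 ∨ α₁ ≠ 0
  n₀ : ℕ
  /-- … and its value law at characters of PRIMITIVE level `n + 1`, `n ≥ n₀`. -/
  val_zStar : ∀ (n : ℕ), n₀ ≤ n → ∀ (χ : absoluteGaloisGroup Φ.Kcm →ₜ* ℂˣ),
    (∀ σ ∈ (K.restrictOfFinrankEqTwo (by decide) Φ.Kcm Φ.finrank_Kcm).layerSubgroup (n + 1), χ σ = 1) →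
    IsPrimitiveRoot (((χ Φ.γK : ℂˣ)) : ℂ) (7 ^ (n + 1)) →
    ∀ Lf : ℂ → ℂ, CM.IsDepletedHeckeL Φ.ψ χ (7 * (7 * F.d)) Lf →
      (7 : ℂ) ^ e * val χ zStar =
        ((α₀ : ℂ) + (α₁ : ℂ) * Φ.ιC (algebraMap Φ.Kcm (AlgebraicClosure Φ.Kcm) Φ.sqrtNegSeven)) * Φ.Ω⁻¹ * Lf 1
  /-- (psiK) `ψ(𝔟) ∈ O_K = ℤ[(1+√−7)/2]`: the integer coordinates `2ψ(𝔟) = b₀(𝔟) + b₁(𝔟)√−7` (Skolemised, so that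
  the comparison constant of block (R) is an explicit term, pen D911 (1)/D913). -/
  bCoef₀ : Ideal (𝓞 Φ.Kcm) → ℤ
  bCoef₁ : Ideal (𝓞 Φ.Kcm) → ℤ
  psi_eq : ∀ (𝔟 : Ideal (𝓞 Φ.Kcm)), IsTwist 7 Φ.𝔣 𝔟 →
    2 * CM.heckeCharIdealValue Φ.ψ 𝔟 =
      (bCoef₀ 𝔟 : ℂ) + (bCoef₁ 𝔟 : ℂ) * Φ.ιC (algebraMap Φ.Kcm (AlgebraicClosure Φ.Kcm) Φ.sqrtNegSeven)
  /-- (art) Artin reciprocity on the cyclotomic tower: the exponent `a_𝔟` with `χ(𝔟) = χ(γK)^{a_𝔟}` for every `χ` of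
  finite level (`(𝔟, Kℚ_∞/K) = γK^{a_𝔟}` on `Kℚ_n`; Skolemised). -/
  artExp : Ideal (𝓞 Φ.Kcm) → ℕ
  art : ∀ (𝔟 : Ideal (𝓞 Φ.Kcm)), IsTwist 7 Φ.𝔣 𝔟 → ∀ (χ : absoluteGaloisGroup Φ.Kcm →ₜ* ℂˣ),
    (∃ n : ℕ, ∀ σ ∈ (K.restrictOfFinrankEqTwo (by decide) Φ.Kcm Φ.finrank_Kcm).layerSubgroup n, χ σ = 1) →
      heckeIdealValue χ 𝔟 = (((χ Φ.γK : ℂˣ)) : ℂ) ^ artExp 𝔟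

/-- **`DualExpCompatShape hγ Φ`** :≡ the pinned frame `Φ` ADMITS a dual-exponential value datum.  A predicate (the (r3)
binder of block (R)); nothing asserted. [cite: Kato2004Asterisque, Prop. 15.9 (p. 258), Thm. 12.5 (1) (p. 221), (15.16.1) (p. 265)]
[cite: BlochKato1990, Def. 3.10 (p. 359)] -/
def DualExpCompatShape (hγ : K.IsTopGenerator γ) (Φ : PinnedKatoGenusFrame W K hK I d) : Prop :=
  Nonempty (DualExpValueDatum hγ Φ)

/-- Unfolding `DualExpCompatShape`. [cite: Kato2004Asterisque, (15.16.1) (p. 265)] -/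
theorem dualExpCompatShape_iff (hγ : K.IsTopGenerator γ) (Φ : PinnedKatoGenusFrame W K hK I d) :
    DualExpCompatShape hγ Φ ↔ Nonempty (DualExpValueDatum hγ Φ) :=
  Iff.rfl

/-! ## §2 Elementary API -/

namespace PinnedKatoGenusFrame

variable (Φ : PinnedKatoGenusFrame W K hK I d)

/-- `ιC(√−7)² = −7` in ℂ. [cite: Kato2004Asterisque, §15.11 (p. 260, "K = ℚ(√−N)")] -/
theorem ιC_sqrtNegSeven_sq :
    Φ.ιC (algebraMap Φ.Kcm (AlgebraicClosure Φ.Kcm) Φ.sqrtNegSeven) ^ 2 = -7 := by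
  rw [← map_pow, ← map_pow, Φ.sqrtNegSeven_sq, map_neg, map_neg, map_ofNat, map_ofNat]

/-- `α₀ + α₁·ιC(√−7) ≠ 0` for integers `(α₀, α₁) ≠ 0` (`√−7` is irrational: `α₀² = −7α₁²` is impossible over ℝ).
[cite: Kato2004Asterisque, §15.11 (p. 260)] -/
theorem intCast_add_mul_sqrt_ne_zero {α₀ α₁ : ℤ} (h : α₀ ≠ 0 ∨ α₁ ≠ 0) :
    (α₀ : ℂ) + (α₁ : ℂ) * Φ.ιC (algebraMap Φ.Kcm (AlgebraicClosure Φ.Kcm) Φ.sqrtNegSeven) ≠ 0 := by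
  set s := Φ.ιC (algebraMap Φ.Kcm (AlgebraicClosure Φ.Kcm) Φ.sqrtNegSeven) with hs
  have hs2 : s ^ 2 = -7 := Φ.ιC_sqrtNegSeven_sq
  intro h0
  have h1 : (α₀ : ℂ) ^ 2 = -7 * (α₁ : ℂ) ^ 2 := by
    have : (α₀ : ℂ) = -((α₁ : ℂ) * s) := by linear_combination h0
    rw [this, neg_sq, mul_pow, hs2]; ring
  have h2 : ((α₀ ^ 2 : ℤ) : ℂ) = ((-7 * α₁ ^ 2 : ℤ) : ℂ) := by push_cast; exact h1
  have h3 : (α₀ ^ 2 : ℤ) = -7 * α₁ ^ 2 := by exact_mod_cast h2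
  rcases h with h | h
  · have : 0 < α₀ ^ 2 := by positivity
    have : 0 ≤ α₁ ^ 2 := sq_nonneg _
    omega
  · have : 0 < α₁ ^ 2 := by positivity
    have : 0 ≤ α₀ ^ 2 := sq_nonneg _
    omega

/-- `piK` commutes with the `Λ`-action (`ιS` is `Λ`-linear and injective, `π •` commutes with `Λ` on `A`).
[cite: Kato2004Asterisque, 15.14 (p. 264)] -/
theorem piK_smul (f : IwasawaAlgebra 7) (y : Φ.IK.H) : Φ.piK (f • y) = f • Φ.piK y := by
  apply Φ.ιS_injective
  rw [Φ.ιS_piK, map_smul, map_smul, Φ.ιS_piK, smul_comm]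

/-- The layer maps of (P1) (`endLayerMap`) are the tree's `isogenyLayerMapK` of (L) (same `mapH1AddHom`).
[cite: SerreGaloisCohomology1997, I §2.2] -/
theorem endLayerMap_eq_isogenyLayerMapK {L : Type} [Field L] (V : WeierstrassCurve L) [V.IsElliptic]
    [ContinuousSMul ℤ_[7] (V.tateModule 7)] (φ : WeierstrassCurve.Isogeny V V) (U : Subgroup (absoluteGaloisGroup L))
    (c : H1 (CM.tateRepK V 7) U) : endLayerMap V φ U c = isogenyLayerMapK 7 φ U c := by
  rw [isogenyLayerMapK_eq_mapH1AddHom]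
  rfl

/-- **`piK` IS the constructed CM operator `(φ)_*` of (L)** (same layers; `IK.proj` jointly injective).
[cite: Kato2004Asterisque, 15.14 (p. 264)] -/
theorem piK_eq_isogenyMap (y : Φ.IK.H) :
    Φ.piK y = Φ.IK.isogenyMap Φ.φ Φ.IK Φ.isTopGenerator_γK y := by
  refine Φ.IK.eq_isogenyMap_of_proj_eq Φ.φ Φ.IK Φ.isTopGenerator_γK fun n => ?_
  rw [Φ.proj_piK, endLayerMap_eq_isogenyLayerMapK]

/-- **`piK ∘ piK = −7`** on `𝐇′(S′_W) = Φ.IK.H` (`φ ∘ φ = [−7]`, functoriality of (L)). [cite: SilvermanAEC2009, III.7.4]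
[cite: Kato2004Asterisque, 15.14 (p. 264)] -/
theorem piK_piK (y : Φ.IK.H) : Φ.piK (Φ.piK y) = (-7 : ℤ) • y := by
  rw [Φ.piK_eq_isogenyMap, Φ.piK_eq_isogenyMap]
  exact Φ.IK.isogenyMap_sq_of_comp_self_eq_zsmul Φ.isTopGenerator_γK Φ.φ Φ.φ_sq y

/-- `γK^{7^m} ∈ U_m` (the `m`-th layer subgroup of `Kℚ_∞/K`). [cite: NeukirchSchmidtWingberg2008, XI §1 (ℤ_p-extensions)] -/
theorem γK_pow_mem_layerSubgroup (m : ℕ) :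
    Φ.γK ^ 7 ^ m ∈ (K.restrictOfFinrankEqTwo (by decide) Φ.Kcm Φ.finrank_Kcm).layerSubgroup m := by
  rw [ZpExtension.mem_layerSubgroup, map_pow, toAdd_pow, nsmul_eq_mul, Nat.cast_pow]
  exact dvd_mul_right _ _

/-- For `χ` trivial on `U_m`: `(χ γK)⁻¹ ^ 7^m = 1`. [cite: Kato2004Asterisque, Thm. 12.5 (1) (p. 221)] -/
theorem inv_chi_γK_pow_eq_one {m : ℕ} (χ : absoluteGaloisGroup Φ.Kcm →ₜ* ℂˣ)
    (hχ : ∀ σ ∈ (K.restrictOfFinrankEqTwo (by decide) Φ.Kcm Φ.finrank_Kcm).layerSubgroup m, χ σ = 1) :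
    ((((χ Φ.γK)⁻¹ : ℂˣ)) : ℂ) ^ 7 ^ m = 1 := by
  have h := hχ _ (Φ.γK_pow_mem_layerSubgroup m)
  rw [map_pow] at h
  rw [← Units.val_pow_eq_pow_val, inv_pow, h, inv_one, Units.val_one]

end PinnedKatoGenusFrame

namespace DualExpValueDatum

variable {hγ : K.IsTopGenerator γ} {Φ : PinnedKatoGenusFrame W K hK I d} (D : DualExpValueDatum hγ Φ)

/-- `val χ (f • piK y) = ιC(√−7)·val χ (f • y)`. [cite: Kato2004Asterisque, §15.3 (p. 252) and 15.14 (p. 264)] -/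
theorem val_smul_piK (χ : absoluteGaloisGroup Φ.Kcm →ₜ* ℂˣ) (f : IwasawaAlgebra 7) (y : Φ.IK.H) :
    D.val χ (f • Φ.piK y) = Φ.ιC (algebraMap Φ.Kcm (AlgebraicClosure Φ.Kcm) Φ.sqrtNegSeven) * D.val χ (f • y) := by
  rw [← Φ.piK_smul, D.val_piK]

/-- Integer scalars pass through `val`: `val χ ((c : Λ) • x) = c·val χ x` (`ι₇` is the identity on ℤ).
[cite: Kato2004Asterisque, Thm. 12.5 (1) (p. 221)] -/
theorem val_intCast_smul (χ : absoluteGaloisGroup Φ.Kcm →ₜ* ℂˣ) (c : ℤ) (x : Φ.IK.H) :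
    D.val χ ((c : IwasawaAlgebra 7) • x) = (c : ℂ) * D.val χ x := by
  have h : ((c : IwasawaAlgebra 7)) = PowerSeries.C ((c : ℤ_[7])) := by
    rw [map_intCast]
  rw [h, D.val_C, PadicInt.coe_intCast, map_intCast]

/-- The values of the ★-class are NON-ZERO at every good character where `L_{7f}(ψ̄, χ, 1) ≠ 0` (`α ≠ 0`, `Ω ≠ 0`).
[cite: Kato2004Asterisque, Thm. 12.5 (2) (p. 221) and 13.5 (p. 227)] -/
theorem val_zStar_ne_zero {n : ℕ} (hn : D.n₀ ≤ n) (χ : absoluteGaloisGroup Φ.Kcm →ₜ* ℂˣ)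
    (hχ : ∀ σ ∈ (K.restrictOfFinrankEqTwo (by decide) Φ.Kcm Φ.finrank_Kcm).layerSubgroup (n + 1), χ σ = 1)
    (hprim : IsPrimitiveRoot (((χ Φ.γK : ℂˣ)) : ℂ) (7 ^ (n + 1)))
    {Lf : ℂ → ℂ} (hLf : CM.IsDepletedHeckeL Φ.ψ χ (7 * (7 * F.d)) Lf) (hL1 : Lf 1 ≠ 0) :
    D.val χ D.zStar ≠ 0 := by
  intro h0
  have h := D.val_zStar n hn χ hχ hprim Lf hLf
  rw [h0, mul_zero] at h
  have hne : ((D.α₀ : ℂ) + (D.α₁ : ℂ) * Φ.ιC (algebraMap Φ.Kcm (AlgebraicClosure Φ.Kcm) Φ.sqrtNegSeven)) * Φ.Ω⁻¹ * Lf 1 ≠ 0 :=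
    mul_ne_zero (mul_ne_zero (Φ.intCast_add_mul_sqrt_ne_zero D.α_ne_zero) (inv_ne_zero Φ.Ω_ne_zero)) hL1
  exact hne h.symm

/-! ## §3 The EXPLICIT data of block (R) and the exact-constant comparison shapes (pen D911 (1)/D913) -/

/-- **`D.xTilde 𝔟 ∈ Λ_O`** — the explicit element `2N𝔟 − (b₀(𝔟) + b₁(𝔟)·π)·(1+X)^{a_𝔟}` (`π ↔ √−7`,
`(1+X)^{a_𝔟} ↔ σ_𝔟`): TWICE Kato's `x_𝔟 = «N𝔟 − ψ(𝔟)σ_𝔟»` read in `Λ_O` (its `χ`-component value is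
`2(N𝔟 − ψ(𝔟)χ(𝔟)⁻¹)`, (15.9.1)/(15.12.2)).  It stands in for `Φ.frame.x 𝔟`, an UNPINNED field of `Frame1516` (the
pinned frame records no relation between `frame.x`, `N𝔟`, `ψ(𝔟)` and `σ_𝔟`), in the exact-constant shapes below.
[cite: Kato2004Asterisque, (15.12.2) (p. 263) and 15.14 (p. 264)] -/
def xTilde (𝔟 : Ideal (𝓞 Φ.Kcm)) : Φ.R :=
  algebraMap (IwasawaAlgebra 7) Φ.R
      ((((2 * Ideal.absNorm 𝔟 : ℕ) : ℤ) : IwasawaAlgebra 7) -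
        (D.bCoef₀ 𝔟 : IwasawaAlgebra 7) * (1 + PowerSeries.X : IwasawaAlgebra 7) ^ D.artExp 𝔟) -
    algebraMap (IwasawaAlgebra 7) Φ.R (D.bCoef₁ 𝔟 : IwasawaAlgebra 7) *
      algebraMap (IwasawaAlgebra 7) Φ.R ((1 + PowerSeries.X : IwasawaAlgebra 7) ^ D.artExp 𝔟) * Φ.π

/-- **`D.cZ ∈ Λ_O`** — the explicit right constant `(α₀ − α₁π)·7^e · uStar⁻¹·7^k·u·π^a` of block (R): `ᾱ·7^e` from the
value law (eZ) and `uStar⁻¹·7^k·u·π^a` from `uStar • zStar = res zOne`, `j(zOne) = 7^k·u·π^a·zS` ((P3) `j_zOne`).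
[cite: Kato2004Asterisque, (15.16.1) (p. 265) and Thm. 12.5 (1) (p. 221)] -/
def cZ : Φ.R :=
  ((algebraMap (IwasawaAlgebra 7) Φ.R (D.α₀ : IwasawaAlgebra 7) -
        algebraMap (IwasawaAlgebra 7) Φ.R (D.α₁ : IwasawaAlgebra 7) * Φ.π) *
      algebraMap (IwasawaAlgebra 7) Φ.R ((7 ^ D.e : ℤ) : IwasawaAlgebra 7)) *
    (algebraMap (IwasawaAlgebra 7) Φ.R (↑(D.uStar⁻¹) : IwasawaAlgebra 7) *
      (algebraMap (IwasawaAlgebra 7) Φ.R ((7 : IwasawaAlgebra 7) ^ Φ.k) * ((Φ.u : Φ.R) * Φ.π ^ Φ.a)))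

/-- `N(α) = α₀² + 7α₁²` as a natural number. [cite: Kato2004Asterisque, (15.16.1) (p. 265)] -/
def normA : ℕ := (D.α₀ ^ 2 + 7 * D.α₁ ^ 2).toNat

/-- `jα = v₇(N(α))`, the `7`-exponent by which block (R) scales the period side (`n = m₀ + 2jα`).
[cite: Kato2004Asterisque, (15.16.1) (p. 265)] -/
def jα : ℕ := D.normA.factorization 7

/-- `(normA : ℤ) = α₀² + 7α₁²` and `normA ≠ 0`. [cite: Kato2004Asterisque, (15.16.1) (p. 265)] -/
theorem natCast_normA : (D.normA : ℤ) = D.α₀ ^ 2 + 7 * D.α₁ ^ 2 ∧ D.normA ≠ 0 := by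
  have hpos : 0 < D.α₀ ^ 2 + 7 * D.α₁ ^ 2 := by
    rcases D.α_ne_zero with h | h
    · have := sq_pos_of_ne_zero h; nlinarith [sq_nonneg D.α₁]
    · have := sq_pos_of_ne_zero h; nlinarith [sq_nonneg D.α₀]
  have h1 : (D.normA : ℤ) = D.α₀ ^ 2 + 7 * D.α₁ ^ 2 := Int.toNat_of_nonneg hpos.le
  exact ⟨h1, fun h0 => by rw [h0] at h1; push_cast at h1; omega⟩

/-- **`D.wα ∈ Λ_O`** — the explicit left unit `v^{jα}·(2·N(α)/7^{jα})` of block (R): `π^{m₀}·2N(α) = wα·π^{m₀ + 2jα}`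
(`7 = v·π²`); a UNIT of `Λ_O` since `7 ∤ 2·N(α)/7^{jα}` (proved in block (R), `DualExpValueDatum.isUnit_wα`).
[cite: Kato2004Asterisque, (15.16.1) (p. 265)] -/
def wα : Φ.R :=
  (Φ.v : Φ.R) ^ D.jα * algebraMap (IwasawaAlgebra 7) Φ.R ((2 * (D.normA / 7 ^ D.jα) : ℕ) : IwasawaAlgebra 7)

end DualExpValueDatum

/-- **`TwoSidedComparisonShape Φ x s c`** :≡ `s • EU_𝔟 = (c·x_𝔟) • 𝐳_{γ′}` for every admissible `𝔟`, with BOTH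
constants `s, c ∈ Λ_O` NAMED and the position element `x : 𝔟 ↦ x_𝔟 ∈ Λ_O` a PARAMETER (for `Φ.frame.x` when a frame
pins it; for `D.xTilde` in block (R)).  Re-stated from idea-20's workfile `Cruxes/EllipticUnitValueSevenOfGZK/
DivisibilityKernelRecut_g64.lean` §6 (REV 1.1 73a8012c33a4fee3, commit bfa48bf0f321; workfiles are not importable), so
that `divisibility_iff_le`-type lemmas turn the kernel into an exponent comparison.  A predicate; nothing asserted.
[cite: Kato2004Asterisque, 15.14 (p. 264) and (15.16.1) (p. 265)] -/
def TwoSidedComparisonShape (Φ : PinnedKatoGenusFrame W K hK I d) (x : Ideal (𝓞 Φ.Kcm) → Φ.R) (s c : Φ.R) : Prop :=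
  ∀ 𝔟 : Ideal (𝓞 Φ.Kcm), IsTwist 7 Φ.𝔣 𝔟 → s • Φ.frame.EU 𝔟 = (c * x 𝔟) • Φ.frame.zeta

/-- **`PeriodScaledComparisonShape Φ x n c`** :≡ `π^n • EU_𝔟 = (c·x_𝔟) • 𝐳_{γ′}` for every admissible `𝔟` (the
exact-constant form of Kato's (15.16.1)∘15.14 with the period side scaled by the NAMED power `π^n`).  A predicate; nothing
asserted. [cite: Kato2004Asterisque, 15.14 (p. 264) and (15.16.1) (p. 265)] -/
def PeriodScaledComparisonShape (Φ : PinnedKatoGenusFrame W K hK I d) (x : Ideal (𝓞 Φ.Kcm) → Φ.R) (n : ℕ) (c : Φ.R) :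
    Prop :=
  ∀ 𝔟 : Ideal (𝓞 Φ.Kcm), IsTwist 7 Φ.𝔣 𝔟 → Φ.π ^ n • Φ.frame.EU 𝔟 = (c * x 𝔟) • Φ.frame.zeta

/-- Period-scaled ⇒ (P3)'s `RationalComparisonShape` (forget the constants). [cite: Kato2004Asterisque, (15.16.1) (p. 265)] -/
theorem PeriodScaledComparisonShape.rational {Φ : PinnedKatoGenusFrame W K hK I d} {x : Ideal (𝓞 Φ.Kcm) → Φ.R}
    {n : ℕ} {c : Φ.R} (h : PeriodScaledComparisonShape Φ x n c) : RationalComparisonShape Φ :=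
  fun 𝔟 h𝔟 => ⟨n, c * x 𝔟, h 𝔟 h𝔟⟩

/-- Two-sided with `s = w·π^n`, `w ∈ Λ_Oˣ` ⇒ period-scaled with constant `w⁻¹·c`. [cite: Kato2004Asterisque, (15.16.1) (p. 265)] -/
theorem TwoSidedComparisonShape.periodScaled {Φ : PinnedKatoGenusFrame W K hK I d} {x : Ideal (𝓞 Φ.Kcm) → Φ.R}
    {s c : Φ.R} (h : TwoSidedComparisonShape Φ x s c) (w : Φ.Rˣ) (n : ℕ) (hs : s = (w : Φ.R) * Φ.π ^ n) :
    PeriodScaledComparisonShape Φ x n ((↑(w⁻¹) : Φ.R) * c) := by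
  intro 𝔟 h𝔟
  have h1 := h 𝔟 h𝔟
  rw [hs] at h1
  calc Φ.π ^ n • Φ.frame.EU 𝔟 = ((↑(w⁻¹) : Φ.R) * ((w : Φ.R) * Φ.π ^ n)) • Φ.frame.EU 𝔟 := by
        rw [← mul_assoc, Units.inv_mul, one_mul]
    _ = (↑(w⁻¹) : Φ.R) • (((w : Φ.R) * Φ.π ^ n) • Φ.frame.EU 𝔟) := mul_smul _ _ _
    _ = (↑(w⁻¹) : Φ.R) • ((c * x 𝔟) • Φ.frame.zeta) := by rw [h1]
    _ = _ := by rw [smul_smul, ← mul_assoc]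

/-- Two-sided ⇒ rational when `s = w·π^n`. [cite: Kato2004Asterisque, (15.16.1) (p. 265)] -/
theorem TwoSidedComparisonShape.rational {Φ : PinnedKatoGenusFrame W K hK I d} {x : Ideal (𝓞 Φ.Kcm) → Φ.R}
    {s c : Φ.R} (h : TwoSidedComparisonShape Φ x s c) (w : Φ.Rˣ) (n : ℕ) (hs : s = (w : Φ.R) * Φ.π ^ n) :
    RationalComparisonShape Φ :=
  (h.periodScaled w n hs).rational

end Frame

end Summit.BirchSwinnertonDyer.Rank1Residual.Additive.GenusSeven

end
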